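import Summits.ValiantsHypothesis.ValiantsHypothesis.Theorems.LangWeilTransferTameResolutionFlatMaps

/-!
# LangWeilTransfer, support item `TameResolution` (stmt-ValiantsHypothesis-6378) — sizes of the
# denominator `ρ` and of the numerators `V_j` of the Kronecker parametrisation

Route `LangWeilTransfer` of `ValiantsHypothesis` (conditional route; honest framing: bookkeeping,
nothing here bears on VP ≠ VNP). Quantitative pass, third link of the size chain (roadmap note of
val-lit-p6 g9, §4 (S)), for the data of `exists_parametrisation_explicit`:
`ρ = sp_c Res ∈ ℤ[T]` and `(finSuccEquiv ℤ r)⁻¹ V_j = -aeval g (∂_v (Flat q) · Flat B)`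
(`LangWeilTransferTameResolutionFlatMaps`), so their degrees and weights follow from those of
`flat₁ Res`, `Flat q`, `Flat B` and the bound `c ≤ N_c` by the size calculus.

* `rho_sizes` — `deg ρ ≤ D_R`, `wt ρ ≤ W_R · N_c^{D_R}`;
* `V_sizes` — `deg (finSuccEquiv⁻¹ V_j) ≤ D_q + D_B`, `wt ≤ D_q W_q W_B N_c^{D_q + D_B}`.
-/

noncomputable section

open MvPolynomial
open Literature.Computability.AlgebraicComplexity

-- the summit and the problem share the name `ValiantsHypothesis` (D-0017 single-conjunct layout)
set_option linter.dupNamespace false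

namespace Summit.ValiantsHypothesis.ValiantsHypothesis.Theorems.LangWeilTransfer

variable {r n : ℕ}

/-- **Sizes of `ρ = sp_c Res`.** -/
theorem rho_sizes (c : Fin n → ℕ) {Nc DR WR : ℕ} (hNc : 1 ≤ Nc) (hc : ∀ j, c j ≤ Nc)
    (Res : MvPolynomial (Fin n) (MvPolynomial (Fin r) ℤ))
    (hD : (rename finSumFinEquiv ((sumAlgEquiv ℤ (Fin n) (Fin r)).symm Res)).totalDegree ≤ DR)
    (hW : weight (rename finSumFinEquiv ((sumAlgEquiv ℤ (Fin n) (Fin r)).symm Res)) ≤ WR) :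
    let sp : MvPolynomial (Fin n) (MvPolynomial (Fin r) ℤ) →+* MvPolynomial (Fin r) ℤ :=
      eval fun j => ((c j : ℕ) : MvPolynomial (Fin r) ℤ)
    (sp Res).totalDegree ≤ DR ∧ weight (sp Res) ≤ WR * Nc ^ DR := by
  intro sp
  set f := (sumAlgEquiv ℤ (Fin n) (Fin r)).symm Res with hf
  have hRes : Res = sumAlgEquiv ℤ (Fin n) (Fin r) f := by rw [hf, AlgEquiv.apply_symm_apply]
  -- the renaming by `finSumFinEquiv` preserves weight and total degree
  have hwf : weight f ≤ WR := by
    rw [← weight_rename_of_injective (Equiv.injective (finSumFinEquiv (m := n) (n := r)))]; exact hW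
  have hdf : f.totalDegree ≤ DR := by
    have h2 := totalDegree_rename_le (finSumFinEquiv (m := n) (n := r)).symm (rename finSumFinEquiv f)
    rw [rename_rename, Equiv.symm_comp_self, rename_id] at h2
    exact h2.trans hD
  have h1 := totalDegree_specC_le (r := r) c f
  have h2 := weight_specC_le (r := r) c hNc hc f
  simp only at h1 h2
  rw [hRes]
  refine ⟨h1.trans hdf, h2.trans ?_⟩
  exact Nat.mul_le_mul hwf (Nat.pow_le_pow_right hNc hdf)

/-- **Sizes of the numerators `V_j = -(∂_{Λ_j} q · B)(Λ := c)`**, as flat polynomials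
`(finSuccEquiv ℤ r)⁻¹ V_j ∈ ℤ[Fin (r+1)]`. -/
theorem V_sizes (c : Fin n → ℕ) {Nc Dq Wq DB WB : ℕ} (hNc : 1 ≤ Nc) (hc : ∀ j, c j ≤ Nc)
    (q B : Polynomial (MvPolynomial (Fin n) (MvPolynomial (Fin r) ℤ))) (j : Fin n) :
    let flat₁ : MvPolynomial (Fin n) (MvPolynomial (Fin r) ℤ) →+* MvPolynomial (Fin (n + r)) ℤ :=
      (rename finSumFinEquiv : MvPolynomial (Fin n ⊕ Fin r) ℤ →ₐ[ℤ] MvPolynomial (Fin (n + r)) ℤ).toRingHom.comp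
        (sumAlgEquiv ℤ (Fin n) (Fin r)).symm.toRingEquiv.toRingHom
    let sp : MvPolynomial (Fin n) (MvPolynomial (Fin r) ℤ) →+* MvPolynomial (Fin r) ℤ :=
      eval fun j => ((c j : ℕ) : MvPolynomial (Fin r) ℤ)
    let dq := optionEquivLeft _ (Fin n) (pderiv (some j) ((optionEquivLeft _ (Fin n)).symm q))
    let V := -((dq * B).map sp)
    ((finSuccEquiv ℤ (n + r)).symm (q.map flat₁)).totalDegree ≤ Dq →
    weight ((finSuccEquiv ℤ (n + r)).symm (q.map flat₁)) ≤ Wq →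
    ((finSuccEquiv ℤ (n + r)).symm (B.map flat₁)).totalDegree ≤ DB →
    weight ((finSuccEquiv ℤ (n + r)).symm (B.map flat₁)) ≤ WB →
    ((finSuccEquiv ℤ r).symm V).totalDegree ≤ Dq + DB ∧
      weight ((finSuccEquiv ℤ r).symm V) ≤ Dq * Wq * WB * Nc ^ (Dq + DB) := by
  intro flat₁ sp dq V hDq hWq hDB hWB
  set Fq := (finSuccEquiv ℤ (n + r)).symm (q.map flat₁) with hFq
  set FB := (finSuccEquiv ℤ (n + r)).symm (B.map flat₁) with hFB
  set v := Fin.succ (finSumFinEquiv (Sum.inl j : Fin n ⊕ Fin r)) with hv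
  -- `Flat (dq * B) = ∂_v Fq * FB` and `Λ ↦ c` is an `aeval`
  have hflat : (finSuccEquiv ℤ (n + r)).symm ((dq * B).map flat₁) = pderiv v Fq * FB := by
    rw [Polynomial.map_mul, map_mul]
    have h := Flat_dq (r := r) j q
    simp only at h
    rw [h]
  have hspec := Flat_map_specC (r := r) c (dq * B)
  simp only at hspec
  set g : Fin (n + r + 1) → MvPolynomial (Fin (r + 1)) ℤ :=
    Fin.cases (X 0) (fun v => Sum.elim (fun j => C ((c j : ℕ) : ℤ)) (fun k => X k.succ) (finSumFinEquiv.symm v))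
    with hg
  have hg_wt : ∀ w, weight (g w) ≤ Nc := by
    intro w
    refine Fin.cases ?_ (fun w' => ?_) w
    · simp only [hg, Fin.cases_zero]
      rw [show (X 0 : MvPolynomial (Fin (r + 1)) ℤ) = monomial (Finsupp.single 0 1) 1 from rfl, weight_monomial]
      exact hNc
    · simp only [hg, Fin.cases_succ]
      obtain ⟨v, rfl⟩ : ∃ v, w' = finSumFinEquiv v := ⟨finSumFinEquiv.symm w', (Equiv.apply_symm_apply _ _).symm⟩
      rw [Equiv.symm_apply_apply]
      rcases v with j' | k
      · rw [Sum.elim_inl, weight_C, Int.natAbs_natCast]; exact hc j'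
      · rw [Sum.elim_inr, show (X k.succ : MvPolynomial (Fin (r + 1)) ℤ) = monomial (Finsupp.single k.succ 1) 1 from rfl,
          weight_monomial]; exact hNc
  have hg_deg : ∀ w, (g w).totalDegree ≤ 1 := by
    intro w
    refine Fin.cases ?_ (fun w' => ?_) w
    · simp only [hg, Fin.cases_zero, totalDegree_X]; exact le_rfl
    · simp only [hg, Fin.cases_succ]
      obtain ⟨v, rfl⟩ : ∃ v, w' = finSumFinEquiv v := ⟨finSumFinEquiv.symm w', (Equiv.apply_symm_apply _ _).symm⟩
      rw [Equiv.symm_apply_apply]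
      rcases v with j' | k
      · rw [Sum.elim_inl, totalDegree_C]; exact Nat.zero_le _
      · rw [Sum.elim_inr, totalDegree_X]
  -- sizes of `∂_v Fq * FB`
  have hPdeg : (pderiv v Fq * FB).totalDegree ≤ Dq + DB :=
    (totalDegree_mul _ _).trans (Nat.add_le_add ((totalDegree_pderiv_le _ _).trans hDq) hDB)
  have hPwt : weight (pderiv v Fq * FB) ≤ Dq * Wq * WB := by
    refine (weight_mul_le _ _).trans (Nat.mul_le_mul ?_ hWB)
    refine (weight_pderiv_le _ _).trans ?_
    exact Nat.mul_le_mul ((degreeOf_le_totalDegree _ _).trans hDq) hWq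
  have hVflat : (finSuccEquiv ℤ r).symm V = -aeval g (pderiv v Fq * FB) := by
    change (finSuccEquiv ℤ r).symm (-((dq * B).map sp)) = _
    rw [map_neg, hspec, hflat]
  refine ⟨?_, ?_⟩
  · rw [hVflat, totalDegree_neg]
    exact (totalDegree_aeval_le_mul g (e := 1) hg_deg _).trans (by rw [one_mul]; exact hPdeg)
  · rw [hVflat, weight_neg]
    refine (weight_aeval_le_mul_pow g hNc hg_wt _).trans ?_
    exact Nat.mul_le_mul hPwt (Nat.pow_le_pow_right hNc hPdeg)

end Summit.ValiantsHypothesis.ValiantsHypothesis.Theorems.LangWeilTransfer
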